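import Summits.QuantumFields.YangMills.Theorems.BalabanUVNodesN08HaarCompatibilityForests
import Summits.QuantumFields.YangMills.Theorems.BalabanUVNodesN08HaarCompatibilityGuardHybridCovariance
import Literature.MathematicalPhysics.QuantumFieldTheory.Balaban1983to89.TorusHypercubicSymmetry

/-!
# BalabanUVNodes ∕ N08 — THE CONDITIONAL FOREST PRINCIPLE: under a finite law invariant under the gauge transformations AT THE PRIVATE ENDPOINTS of an acyclic family `b`,
# the bond variables `V ∘ b` are product Haar AND INDEPENDENT OF EVERY SPECTATOR those transformations fix — e.g. three bonds of a coarse plaquette are `Haar³`, independent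
# of the plaquette's holonomy: the law of a plaquette's four variables is `Haar³ ⊗ κ_p`, `κ_p` the law of the holonomy

WIDTH SEAT `pub-ymgap-dag-n08-w3` g7, item-3 lineage PART 42 (successor of the g0 part 4 `…HaarCompatibilityForests` (forests are product Haar under gauge-invariant laws) and of
parts 39∕41 (forest polymers invisible)), 2026-08-28.  Track A, DAG node N08 = [Balaban1985UV3] Thm 1 p. 257 (compact) + Thm 2 p. 272; key item K1⁷ `StabilityBAtRecordR13SepCoPH`
(stmt-QuantumFields-20542), `--supports … --as helper`.  COUNT-NEUTRAL.

THE POINT (located; road (ii) bookkeeping, n08-w1 g6 `N08-NO-STACKING-MECHANISM.md` §3∕§5; count-neutral).  Parts 39∕41: polymers whose near family is ACYCLIC are transported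
to constants.  The first shape-carrying polymers have a coarse PLAQUETTE among their near bonds.  This file says what shape they can carry.  g0 part 4's induction uses, bond
by bond, only the gauge transformation supported at the bond's PRIVATE endpoint; so (§2) it holds for laws invariant under those transformations only, and (§3) — restricting
the law to the level sets of any measurable SPECTATOR `φ` fixed by them — **`law(V ∘ b, φ) = Haar^n ⊗ law(φ)`**: the forest variables are fresh Haar GIVEN `φ`.  For a coarse
plaquette `p = (x; μ < ν)` (§4): the path `(x,μ), (x+e_μ,ν), (x+e_ν,μ)` is acyclic with private endpoints `x+e_μ, x+e_μ+e_ν, x+e_ν`, and the holonomy `V(∂p)` (based at `x`)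
is fixed by the transformations there; hence under EVERY finite gauge-invariant law (below the top level)
  **`law(V(x,μ), V(x+e_μ,ν), V(x+e_ν,μ), V(∂p)) = Haar³ ⊗ law(V(∂p))`.**
READING for the polymer bookkeeping: the transported density of a polymer whose near family is a plaquette is a function of the plaquette HOLONOMY alone (its law `κ_p`
against Haar); with parts 38A∕40 this is the precise sense of «the shape of the floored Haar iterate lives in cycle holonomies».

* §1 `signedEval_gaugeAct_single` (the private-endpoint transformation, explicitly: right translation of the last signed coordinate, the others fixed).
* §2 `map_signedEvalFamily_eq_pi_haar_of_invariant_at` (probability laws invariant at the private endpoints), `map_signedEvalFamily_eq_mass_smul_of_invariant_at` (finite laws).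
* §3 ★★★ `map_signedEvalFamily_prod_eq_of_invariant_at` ∕ `map_evalFamily_prod_eq_of_invariant_at` (WITH SPECTATOR: `law(V∘b, φ) = Haar^n ⊗ law(φ)`), and the gauge-invariant
  corollary `map_evalFamily_prod_eq_of_gaugeInvariant`.
* §4 ★★★ `map_plaquetteTree_prod_plaqHol` (three bonds of a plaquette ⊗ its holonomy, every finite gauge-invariant law, below the top level).

HONEST FRAMING.  [folklore] measure theory (Weil uniqueness bond by bond, as in g0 part 4); nothing of Bałaban's asserted; NO bound, NO cluster expansion ∕ (G3), NO k-uniform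
`hmass`; E6′ NOT decided; N08 NOT discharged; counts unmoved (typed 28∕28 · discharged 5∕27); one finite 𝕋⁴ programme at fixed ε — R4 closes the CONDITIONAL rung `BalabanLadder.UV`
only; the Yang–Mills mass gap (Clay) is NOT proved by any of this; nothing continuum ∕ ℝ⁴ ∕ OS.  0 `sorry`, 0 `def`, 0 `instance`, standard axioms.
-/

noncomputable section

open MeasureTheory
open scoped ENNReal

namespace Summit.QuantumFields.YangMills.BalabanUVNodes.N08HaarCompatibilityForestsSpectator

open Literature.MathematicalPhysics.QuantumFieldTheory.Balaban1983to89
open Literature.MathematicalPhysics.QuantumFieldTheory.Balaban1983to89.B12RTGaugeInvariance254 (measurable_gaugeAct)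
open Literature.MathematicalPhysics.QuantumFieldTheory.Balaban1983to89.B12SmallFieldDomain259 (src_ne_tgt)
open Summit.QuantumFields.YangMills.BalabanUVNodes.N08HaarCompatibilityForests
  (eq_mass_smul_haar_of_map_mul_right measurable_signedEvalFamily map_signFix_pi_haar)
open Summit.QuantumFields.YangMills.BalabanUVNodes.N08HaarCompatibilityGuardHybridCovariance (shift_injective_dir shift_shift_ne_self)

/-! ## §1 The private-endpoint transformation -/

section Generic

variable {P : Params} {k : ℕ} {G : Type*} [GaugeGroup G] [MeasurableSpace G] [HaarData G] [MeasurableMul₂ G] [MeasurableInv G]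

omit [MeasurableSpace G] [HaarData G] [MeasurableMul₂ G] [MeasurableInv G] in
/-- **The gauge transformation `y ↦ (y = x_last ? g : 1)` at the private endpoint of the LAST bond** right-translates the last signed coordinate by `g⁻¹` and fixes every earlier
one (g0 part 4's `exists_gaugeTransf_last`, with the transformation explicit). [cite: Balaban1985Averaging, (8) p.19 (bookkeeping)] -/
theorem signedEval_gaugeAct_single {n : ℕ} (b : Fin (n + 1) → PBond P k) (side : Fin (n + 1) → Bool)
    (hleaf : ∀ m m' : Fin (n + 1), m' < m →
      (if side m then (b m).src else (b m).tgt) ≠ (b m').src ∧ (if side m then (b m).src else (b m).tgt) ≠ (b m').tgt)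
    (g : G) (V : GaugeField P k G) :
    (fun m : Fin (n + 1) => if side m then
        (GaugeField.gaugeAct (fun y => if y = (if side (Fin.last n) then (b (Fin.last n)).src else (b (Fin.last n)).tgt) then g else 1) V (b m))⁻¹
      else GaugeField.gaugeAct (fun y => if y = (if side (Fin.last n) then (b (Fin.last n)).src else (b (Fin.last n)).tgt) then g else 1) V (b m)) =
      fun m => if m = Fin.last n then (if side m then (V (b m))⁻¹ else V (b m)) * g⁻¹ else (if side m then (V (b m))⁻¹ else V (b m)) := by
  classical
  set x : Site P k := if side (Fin.last n) then (b (Fin.last n)).src else (b (Fin.last n)).tgt with hx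
  funext m
  by_cases hm : m = Fin.last n
  · subst hm
    rw [if_pos rfl]
    cases hs : side (Fin.last n)
    · have hxt : x = (b (Fin.last n)).tgt := by rw [hx, hs]; rfl
      have hsrc : (b (Fin.last n)).src ≠ x := by rw [hxt]; exact src_ne_tgt _
      simp only [GaugeField.gaugeAct, Bool.false_eq_true, if_false]
      rw [if_neg hsrc, if_pos hxt.symm, one_mul]
    · have hxs : x = (b (Fin.last n)).src := by rw [hx, hs]; rfl
      have htgt : (b (Fin.last n)).tgt ≠ x := by rw [hxs]; exact fun h => src_ne_tgt _ h.symm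
      simp only [GaugeField.gaugeAct, if_true]
      rw [if_pos hxs.symm, if_neg htgt, inv_one, mul_one, mul_inv_rev]
  · rw [if_neg hm]
    have hlt : m < Fin.last n := lt_of_le_of_ne (Fin.le_last m) hm
    have h1 : (b m).src ≠ x := fun h => (hleaf (Fin.last n) m hlt).1 (by rw [hx] at h; exact h.symm)
    have h2 : (b m).tgt ≠ x := fun h => (hleaf (Fin.last n) m hlt).2 (by rw [hx] at h; exact h.symm)
    simp only [GaugeField.gaugeAct]
    rw [if_neg h1, if_neg h2, one_mul, inv_one, mul_one]

/-! ## §2 Forests under laws invariant AT THE PRIVATE ENDPOINTS -/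

/-- **FORESTS ARE PRODUCT HAAR UNDER EVERY PROBABILITY LAW INVARIANT AT THE PRIVATE ENDPOINTS** (signed coordinates): g0 part 4's induction verbatim, reading only the
invariance under `y ↦ (y = x_m ? g : 1)`, `x_m` the private endpoint of `b m`. [cite: Balaban1987RG1, (2.1) p.265 (the gauge-invariance sentence this reads); folklore] -/
theorem map_signedEvalFamily_eq_pi_haar_of_invariant_at (n : ℕ) :
    ∀ (b : Fin n → PBond P k) (side : Fin n → Bool)
      (_hleaf : ∀ m m' : Fin n, m' < m →
        (if side m then (b m).src else (b m).tgt) ≠ (b m').src ∧ (if side m then (b m).src else (b m).tgt) ≠ (b m').tgt)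
      (ν : Measure (GaugeField P k G)) [IsProbabilityMeasure ν]
      (_hν : ∀ (m : Fin n) (g : G), ν.map (GaugeField.gaugeAct fun y => if y = (if side m then (b m).src else (b m).tgt) then g else 1) = ν),
      ν.map (fun (V : GaugeField P k G) (m : Fin n) => if side m then (V (b m))⁻¹ else V (b m)) =
        Measure.pi fun _ : Fin n => (HaarData.haar : Measure G) := by
  classical
  induction n with
  | zero =>
    intro b side _ ν _ _
    haveI : IsProbabilityMeasure (ν.map fun (V : GaugeField P k G) (m : Fin 0) => if side m then (V (b m))⁻¹ else V (b m)) :=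
      Measure.isProbabilityMeasure_map (measurable_signedEvalFamily b side).aemeasurable
    ext s _
    rcases Set.eq_empty_or_nonempty s with h | h
    · rw [h, measure_empty, measure_empty]
    · rw [Subsingleton.eq_univ_of_nonempty h, measure_univ, measure_univ]
  | succ n ih =>
    intro b side hleaf ν _ hν
    set Ψ : GaugeField P k G → (Fin (n + 1) → G) := fun V m => if side m then (V (b m))⁻¹ else V (b m) with hΨ
    have hΨm : Measurable Ψ := measurable_signedEvalFamily b side
    set ρ : Measure (Fin (n + 1) → G) := ν.map Ψ with hρ
    haveI : IsProbabilityMeasure ρ := Measure.isProbabilityMeasure_map hΨm.aemeasurable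
    set Ψ' : GaugeField P k G → (Fin n → G) := fun V j => if side (Fin.castSucc j) then (V (b (Fin.castSucc j)))⁻¹ else V (b (Fin.castSucc j)) with hΨ'
    have hleaf' : ∀ m m' : Fin n, m' < m →
        (if side (Fin.castSucc m) then (b (Fin.castSucc m)).src else (b (Fin.castSucc m)).tgt) ≠ (b (Fin.castSucc m')).src ∧
          (if side (Fin.castSucc m) then (b (Fin.castSucc m)).src else (b (Fin.castSucc m)).tgt) ≠ (b (Fin.castSucc m')).tgt :=
      fun m m' h => hleaf (Fin.castSucc m) (Fin.castSucc m') (Fin.castSucc_lt_castSucc_iff.mpr h)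
    have hIH : ν.map Ψ' = Measure.pi fun _ : Fin n => (HaarData.haar : Measure G) :=
      ih (fun j => b (Fin.castSucc j)) (fun j => side (Fin.castSucc j)) hleaf' ν (fun m g => hν (Fin.castSucc m) g)
    set r : (Fin (n + 1) → G) → (Fin n → G) := fun W j => W (Fin.castSucc j) with hr
    have hrm : Measurable r := measurable_pi_lambda _ fun j => measurable_pi_apply _
    have hrΨ : r ∘ Ψ = Ψ' := by funext V; rfl
    have hρr : ρ.map r = Measure.pi fun _ : Fin n => (HaarData.haar : Measure G) := by
      rw [hρ, Measure.map_map hrm hΨm, hrΨ, hIH]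
    have hTm : ∀ g : G, Measurable fun (W : Fin (n + 1) → G) (m : Fin (n + 1)) => if m = Fin.last n then W m * g else W m := by
      intro g
      refine measurable_pi_lambda _ fun m => ?_
      by_cases hm : m = Fin.last n
      · simp only [hm, if_true]; exact (measurable_pi_apply (Fin.last n) : Measurable fun W : Fin (n + 1) → G => W (Fin.last n)).mul_const g
      · simp only [hm, if_false]; exact (measurable_pi_apply m : Measurable fun W : Fin (n + 1) → G => W m)
    have hρT : ∀ g : G, ρ.map (fun W m => if m = Fin.last n then W m * g else W m) = ρ := by
      intro g
      have hv := signedEval_gaugeAct_single b side hleaf g⁻¹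
      have hT := hTm g
      have hcomp : (fun (W : Fin (n + 1) → G) (m : Fin (n + 1)) => if m = Fin.last n then W m * g else W m) ∘ Ψ =
          Ψ ∘ GaugeField.gaugeAct (fun y => if y = (if side (Fin.last n) then (b (Fin.last n)).src else (b (Fin.last n)).tgt) then g⁻¹ else 1) := by
        funext V
        have h := hv V
        simp only [inv_inv] at h
        simp only [Function.comp, hΨ]
        rw [h]
      rw [hρ, Measure.map_map hT hΨm, hcomp, ← Measure.map_map hΨm (measurable_gaugeAct _), hν (Fin.last n) g⁻¹]
    refine (Measure.pi_eq fun s hs => ?_).symm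
    set C : Set (Fin (n + 1) → G) := {W | ∀ j : Fin n, W (Fin.castSucc j) ∈ s (Fin.castSucc j)} with hC
    have hCeq : C = r ⁻¹' (Set.univ.pi fun j : Fin n => s (Fin.castSucc j)) := by
      ext W; simp [hC, hr]
    have hCm : MeasurableSet C := by
      rw [hCeq]; exact hrm (MeasurableSet.univ_pi fun j => hs (Fin.castSucc j))
    have hρC : ρ C = ∏ j : Fin n, (HaarData.haar : Measure G) (s (Fin.castSucc j)) := by
      rw [hCeq, ← Measure.map_apply hrm (MeasurableSet.univ_pi fun j => hs (Fin.castSucc j)), hρr, Measure.pi_pi]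
    set μC : Measure G := (ρ.restrict C).map (fun W => W (Fin.last n)) with hμC
    have hlastm : Measurable fun W : Fin (n + 1) → G => W (Fin.last n) := measurable_pi_apply _
    haveI : IsFiniteMeasure μC := by rw [hμC]; infer_instance
    have hμC_apply : ∀ A : Set G, MeasurableSet A → μC A = ρ ({W | W (Fin.last n) ∈ A} ∩ C) := by
      intro A hA
      rw [hμC, Measure.map_apply hlastm hA, Measure.restrict_apply (hlastm hA)]
      rfl
    have hμC_inv : ∀ g : G, μC.map (fun x => x * g) = μC := by
      intro g
      ext A hA
      rw [Measure.map_apply (measurable_mul_const g) hA, hμC_apply _ (measurable_mul_const g hA), hμC_apply A hA]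
      have hpre : (fun (W : Fin (n + 1) → G) (m : Fin (n + 1)) => if m = Fin.last n then W m * g else W m) ⁻¹'
          ({W | W (Fin.last n) ∈ A} ∩ C) = {W | W (Fin.last n) * g ∈ A} ∩ C := by
        ext W
        simp only [Set.mem_preimage, Set.mem_inter_iff, Set.mem_setOf_eq, if_true, hC, Fin.castSucc_ne_last, if_false]
      have hT := hTm g
      have hmeasAC : MeasurableSet ({W : Fin (n + 1) → G | W (Fin.last n) ∈ A} ∩ C) := (hlastm hA).inter hCm
      calc ρ ({W | W (Fin.last n) * g ∈ A} ∩ C)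
          = ρ ((fun (W : Fin (n + 1) → G) (m : Fin (n + 1)) => if m = Fin.last n then W m * g else W m) ⁻¹'
              ({W | W (Fin.last n) ∈ A} ∩ C)) := by rw [hpre]
        _ = (ρ.map fun (W : Fin (n + 1) → G) (m : Fin (n + 1)) => if m = Fin.last n then W m * g else W m)
              ({W | W (Fin.last n) ∈ A} ∩ C) := (Measure.map_apply hT hmeasAC).symm
        _ = ρ ({W | W (Fin.last n) ∈ A} ∩ C) := by rw [hρT g]
    have hμC_eq : μC = μC Set.univ • (HaarData.haar : Measure G) := eq_mass_smul_haar_of_map_mul_right μC hμC_inv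
    have hμC_univ : μC Set.univ = ρ C := by
      rw [hμC_apply _ MeasurableSet.univ]
      congr 1
      ext W; simp
    have hbox : Set.univ.pi s = {W : Fin (n + 1) → G | W (Fin.last n) ∈ s (Fin.last n)} ∩ C := by
      ext W
      simp only [Set.mem_univ_pi, Set.mem_inter_iff, Set.mem_setOf_eq, hC]
      rw [Fin.forall_fin_succ']
      exact and_comm
    rw [hbox, ← hμC_apply _ (hs (Fin.last n)), hμC_eq, Measure.smul_apply, smul_eq_mul, hμC_univ, hρC, Fin.prod_univ_castSucc]

/-- **… AND `mass • Haar^n` UNDER EVERY FINITE SUCH LAW** (normalise; the zero law apart). [cite: Balaban1987RG1, (2.1) p.265 (bookkeeping); folklore] -/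
theorem map_signedEvalFamily_eq_mass_smul_of_invariant_at {n : ℕ} (b : Fin n → PBond P k) (side : Fin n → Bool)
    (hleaf : ∀ m m' : Fin n, m' < m →
      (if side m then (b m).src else (b m).tgt) ≠ (b m').src ∧ (if side m then (b m).src else (b m).tgt) ≠ (b m').tgt)
    (ν : Measure (GaugeField P k G)) (hfin : IsFiniteMeasure ν)
    (hν : ∀ (m : Fin n) (g : G), ν.map (GaugeField.gaugeAct fun y => if y = (if side m then (b m).src else (b m).tgt) then g else 1) = ν) :
    ν.map (fun (V : GaugeField P k G) (m : Fin n) => if side m then (V (b m))⁻¹ else V (b m)) = ν Set.univ • Measure.pi fun _ : Fin n => (HaarData.haar : Measure G) := by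
  haveI := HaarData.isProb (G := G)
  haveI := hfin
  by_cases h0 : ν Set.univ = 0
  · rw [h0, zero_smul, Measure.measure_univ_eq_zero.1 h0, Measure.map_zero]
  · have htop : ν Set.univ ≠ ∞ := measure_ne_top _ _
    set ν' : Measure (GaugeField P k G) := (ν Set.univ)⁻¹ • ν with hν'
    haveI : IsProbabilityMeasure ν' := ⟨by rw [hν', Measure.smul_apply, smul_eq_mul, ENNReal.inv_mul_cancel h0 htop]⟩
    have hν'inv : ∀ (m : Fin n) (g : G), ν'.map (GaugeField.gaugeAct fun y => if y = (if side m then (b m).src else (b m).tgt) then g else 1) = ν' :=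
      fun m g => by rw [hν', Measure.map_smul, hν m g]
    have h := map_signedEvalFamily_eq_pi_haar_of_invariant_at n b side hleaf ν' hν'inv
    have hνeq : ν = ν Set.univ • ν' := by rw [hν', smul_smul, ENNReal.mul_inv_cancel h0 htop, one_smul]
    conv_lhs => rw [hνeq]
    rw [Measure.map_smul, h]

/-! ## §3 With a spectator -/

/-- Restricting an `F`-invariant measure to an `F`-invariant set keeps it `F`-invariant (plumbing). [folklore] -/
theorem map_restrict_eq_of_preimage_eq {X : Type*} [MeasurableSpace X] (μ : Measure X) {F : X → X} (hF : Measurable F) (hμ : μ.map F = μ) {E : Set X}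
    (hE : MeasurableSet E) (hFE : F ⁻¹' E = E) : (μ.restrict E).map F = μ.restrict E := by
  ext A hA
  rw [Measure.map_apply hF hA, Measure.restrict_apply (hF hA), Measure.restrict_apply hA]
  conv_lhs => rw [← hFE, ← Set.preimage_inter, ← Measure.map_apply hF (hA.inter hE), hμ]

/-- ★★★ **THE CONDITIONAL FOREST PRINCIPLE (signed coordinates).**  For a finite law `ν` invariant under the gauge transformations at the private endpoints of an acyclic
family `b`, and ANY measurable spectator `φ : GaugeField → X` FIXED by those transformations: **`law(signed V∘b, φ) = Haar^n ⊗ law(φ)`** — the forest variables are product Haar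
and INDEPENDENT of `φ` (§2 applied to `ν` restricted to the level sets `φ⁻¹ t`, which stay invariant; `Measure.prod_eq`). [cite: Balaban1987RG1, (2.1) p.265 (bookkeeping); folklore] -/
theorem map_signedEvalFamily_prod_eq_of_invariant_at {n : ℕ} (b : Fin n → PBond P k) (side : Fin n → Bool)
    (hleaf : ∀ m m' : Fin n, m' < m →
      (if side m then (b m).src else (b m).tgt) ≠ (b m').src ∧ (if side m then (b m).src else (b m).tgt) ≠ (b m').tgt)
    (ν : Measure (GaugeField P k G)) (hfin : IsFiniteMeasure ν)
    (hν : ∀ (m : Fin n) (g : G), ν.map (GaugeField.gaugeAct fun y => if y = (if side m then (b m).src else (b m).tgt) then g else 1) = ν)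
    {X : Type*} [MeasurableSpace X] (φ : GaugeField P k G → X) (hφm : Measurable φ)
    (hφ : ∀ (m : Fin n) (g : G) (V : GaugeField P k G), φ (GaugeField.gaugeAct (fun y => if y = (if side m then (b m).src else (b m).tgt) then g else 1) V) = φ V) :
    ν.map (fun V : GaugeField P k G => ((fun m : Fin n => if side m then (V (b m))⁻¹ else V (b m)), φ V)) =
      (Measure.pi fun _ : Fin n => (HaarData.haar : Measure G)).prod (ν.map φ) := by
  haveI := HaarData.isProb (G := G)
  haveI := hfin
  have hΨm : Measurable fun (V : GaugeField P k G) (m : Fin n) => if side m then (V (b m))⁻¹ else V (b m) := measurable_signedEvalFamily b side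
  haveI : IsFiniteMeasure (ν.map φ) := Measure.isFiniteMeasure_map ν φ
  refine (Measure.prod_eq fun s t hs ht => ?_).symm
  rw [Measure.map_apply (hΨm.prodMk hφm) (hs.prod ht), Measure.map_apply hφm ht]
  have hpre : (fun V : GaugeField P k G => ((fun m : Fin n => if side m then (V (b m))⁻¹ else V (b m)), φ V)) ⁻¹' (s ×ˢ t) =
      (fun (V : GaugeField P k G) (m : Fin n) => if side m then (V (b m))⁻¹ else V (b m)) ⁻¹' s ∩ φ ⁻¹' t := by
    ext V; simp [Set.mem_prod]
  rw [hpre, ← Measure.restrict_apply (hΨm hs), ← Measure.map_apply hΨm hs]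
  -- §2 for the restricted law
  have hres : ∀ (m : Fin n) (g : G), (ν.restrict (φ ⁻¹' t)).map
      (GaugeField.gaugeAct fun y => if y = (if side m then (b m).src else (b m).tgt) then g else 1) = ν.restrict (φ ⁻¹' t) :=
    fun m g => map_restrict_eq_of_preimage_eq ν (measurable_gaugeAct _) (hν m g) (hφm ht) (by ext V; simp [hφ m g V])
  have hfin' : IsFiniteMeasure (ν.restrict (φ ⁻¹' t)) := inferInstance
  rw [map_signedEvalFamily_eq_mass_smul_of_invariant_at b side hleaf _ hfin' hres, Measure.smul_apply, smul_eq_mul, Measure.restrict_apply MeasurableSet.univ,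
    Set.univ_inter, mul_comm]

/-- ★★★ **THE CONDITIONAL FOREST PRINCIPLE: `law(V ∘ b, φ) = Haar^n ⊗ law(φ)`** (un-signed; Haar is inversion invariant). [cite: Balaban1987RG1, (2.1) p.265 (bookkeeping); folklore] -/
theorem map_evalFamily_prod_eq_of_invariant_at {n : ℕ} (b : Fin n → PBond P k) (side : Fin n → Bool)
    (hleaf : ∀ m m' : Fin n, m' < m →
      (if side m then (b m).src else (b m).tgt) ≠ (b m').src ∧ (if side m then (b m).src else (b m).tgt) ≠ (b m').tgt)
    (ν : Measure (GaugeField P k G)) (hfin : IsFiniteMeasure ν)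
    (hν : ∀ (m : Fin n) (g : G), ν.map (GaugeField.gaugeAct fun y => if y = (if side m then (b m).src else (b m).tgt) then g else 1) = ν)
    {X : Type*} [MeasurableSpace X] (φ : GaugeField P k G → X) (hφm : Measurable φ)
    (hφ : ∀ (m : Fin n) (g : G) (V : GaugeField P k G), φ (GaugeField.gaugeAct (fun y => if y = (if side m then (b m).src else (b m).tgt) then g else 1) V) = φ V) :
    ν.map (fun V : GaugeField P k G => ((fun m : Fin n => V (b m)), φ V)) = (Measure.pi fun _ : Fin n => (HaarData.haar : Measure G)).prod (ν.map φ) := by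
  haveI := HaarData.isProb (G := G)
  haveI := hfin
  haveI : IsFiniteMeasure (ν.map φ) := Measure.isFiniteMeasure_map ν φ
  have hF : Measurable fun (W : Fin n → G) (m : Fin n) => if side m then (W m)⁻¹ else W m := by
    refine measurable_pi_lambda _ fun m => ?_
    by_cases hsd : side m = true
    · simp only [hsd, if_true]; exact (measurable_pi_apply m : Measurable fun W : Fin n → G => W m).inv
    · simp only [hsd]; exact (measurable_pi_apply m : Measurable fun W : Fin n → G => W m)
  have hΨm : Measurable fun (V : GaugeField P k G) (m : Fin n) => if side m then (V (b m))⁻¹ else V (b m) := measurable_signedEvalFamily b side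
  have hcomp : (fun V : GaugeField P k G => ((fun m : Fin n => V (b m)), φ V)) =
      (Prod.map (fun (W : Fin n → G) (m : Fin n) => if side m then (W m)⁻¹ else W m) id) ∘
        fun V : GaugeField P k G => ((fun m : Fin n => if side m then (V (b m))⁻¹ else V (b m)), φ V) := by
    funext V
    simp only [Function.comp, Prod.map, id]
    refine Prod.ext ?_ rfl
    funext m
    by_cases hsd : side m = true
    · simp [hsd]
    · simp [hsd]
  rw [hcomp, ← Measure.map_map (hF.prodMap measurable_id) (hΨm.prodMk hφm), map_signedEvalFamily_prod_eq_of_invariant_at b side hleaf ν hfin hν φ hφm hφ,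
    ← Measure.map_prod_map _ _ hF measurable_id, map_signFix_pi_haar side, Measure.map_id]

/-- **Gauge-invariant corollary**: under every finite GAUGE-INVARIANT law, the variables of an acyclic family are `Haar^n`, independent of every measurable spectator fixed by the
transformations at the private endpoints. [cite: Balaban1987RG1, (2.1) p.265 (bookkeeping); folklore] -/
theorem map_evalFamily_prod_eq_of_gaugeInvariant {n : ℕ} (b : Fin n → PBond P k) (side : Fin n → Bool)
    (hleaf : ∀ m m' : Fin n, m' < m →
      (if side m then (b m).src else (b m).tgt) ≠ (b m').src ∧ (if side m then (b m).src else (b m).tgt) ≠ (b m').tgt)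
    (ν : Measure (GaugeField P k G)) (hfin : IsFiniteMeasure ν) (hν : ∀ v : GaugeTransf P k G, ν.map (GaugeField.gaugeAct v) = ν)
    {X : Type*} [MeasurableSpace X] (φ : GaugeField P k G → X) (hφm : Measurable φ)
    (hφ : ∀ (m : Fin n) (g : G) (V : GaugeField P k G), φ (GaugeField.gaugeAct (fun y => if y = (if side m then (b m).src else (b m).tgt) then g else 1) V) = φ V) :
    ν.map (fun V : GaugeField P k G => ((fun m : Fin n => V (b m)), φ V)) = (Measure.pi fun _ : Fin n => (HaarData.haar : Measure G)).prod (ν.map φ) :=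
  map_evalFamily_prod_eq_of_invariant_at b side hleaf ν hfin (fun _ _ => hν _) φ hφm hφ

end Generic

/-! ## §4 The plaquette: three tree bonds ⊗ the holonomy -/

section Plaquette

variable {P : Params} {j : ℕ} {G : Type*} [GaugeGroup G] [MeasurableSpace G] [HaarData G] [MeasurableMul₂ G] [MeasurableInv G]

omit [MeasurableSpace G] [HaarData G] [MeasurableMul₂ G] [MeasurableInv G] in
/-- The plaquette holonomy based at `x` is fixed by every gauge transformation equal to `1` at `x`. [cite: Balaban1985Averaging, (9) p.19 (bookkeeping)] -/
theorem plaqHol_gaugeAct_of_apply_src (p : Plaq P j) (u : GaugeTransf P j G) (hu : u p.src = 1) (V : GaugeField P j G) :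
    GaugeField.plaqHol (GaugeField.gaugeAct u V) p = GaugeField.plaqHol V p := by
  simp only [GaugeField.plaqHol, GaugeField.gaugeAct, PBond.tgt, Site.shift_comm p.src p.ν p.μ, hu]
  group

omit [GaugeGroup G] [MeasurableSpace G] [HaarData G] [MeasurableMul₂ G] [MeasurableInv G] in
/-- **The path `(x,μ), (x+e_μ,ν), (x+e_ν,μ)` of a plaquette is a leaf-extension order** with private endpoints `x+e_μ`, `x+e_μ+e_ν`, `x+e_ν` (below the top level, where
`x+e_μ+e_ν ≠ x`). [cite: Balaban1987RG1, (0.1) p.251 (bookkeeping)] -/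
theorem plaquetteTree_leafOrder (h : j + 1 < P.m + P.K) (p : Plaq P (j + 1)) :
    ∀ m m' : Fin 3, m' < m →
      (if (![false, false, true] : Fin 3 → Bool) m then ((![⟨p.src, p.μ⟩, ⟨p.src.shift p.μ, p.ν⟩, ⟨p.src.shift p.ν, p.μ⟩] : Fin 3 → PBond P (j + 1)) m).src
        else ((![⟨p.src, p.μ⟩, ⟨p.src.shift p.μ, p.ν⟩, ⟨p.src.shift p.ν, p.μ⟩] : Fin 3 → PBond P (j + 1)) m).tgt) ≠
          ((![⟨p.src, p.μ⟩, ⟨p.src.shift p.μ, p.ν⟩, ⟨p.src.shift p.ν, p.μ⟩] : Fin 3 → PBond P (j + 1)) m').src ∧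
      (if (![false, false, true] : Fin 3 → Bool) m then ((![⟨p.src, p.μ⟩, ⟨p.src.shift p.μ, p.ν⟩, ⟨p.src.shift p.ν, p.μ⟩] : Fin 3 → PBond P (j + 1)) m).src
        else ((![⟨p.src, p.μ⟩, ⟨p.src.shift p.μ, p.ν⟩, ⟨p.src.shift p.ν, p.μ⟩] : Fin 3 → PBond P (j + 1)) m).tgt) ≠
          ((![⟨p.src, p.μ⟩, ⟨p.src.shift p.μ, p.ν⟩, ⟨p.src.shift p.ν, p.μ⟩] : Fin 3 → PBond P (j + 1)) m').tgt := by
  have hμν : p.μ ≠ p.ν := ne_of_lt p.hμν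
  have h1 : (p.src.shift p.μ).shift p.ν ≠ p.src := shift_shift_ne_self h p.src p.μ p.ν
  have h2 : (p.src.shift p.μ).shift p.ν ≠ p.src.shift p.μ := fun e => src_ne_tgt (⟨p.src.shift p.μ, p.ν⟩ : PBond P (j + 1)) e.symm
  have h3 : p.src.shift p.ν ≠ p.src := fun e => src_ne_tgt (⟨p.src, p.ν⟩ : PBond P (j + 1)) e.symm
  have h4 : p.src.shift p.ν ≠ p.src.shift p.μ := fun e => hμν (shift_injective_dir p.src e).symm
  have h5 : p.src.shift p.ν ≠ (p.src.shift p.μ).shift p.ν := fun e =>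
    src_ne_tgt (⟨p.src.shift p.ν, p.μ⟩ : PBond P (j + 1)) (e.trans (Site.shift_comm p.src p.μ p.ν))
  intro m m' hmm'
  fin_cases m <;> fin_cases m'
  all_goals first | exact absurd hmm' (by decide) | exact ⟨h1, h2⟩ | exact ⟨h3, h4⟩ | exact ⟨h4, h5⟩

/-- ★★★ **THREE BONDS OF A COARSE PLAQUETTE ARE `Haar³`, INDEPENDENT OF ITS HOLONOMY, UNDER EVERY FINITE GAUGE-INVARIANT LAW** (below the top level):
`law(V(x,μ), V(x+e_μ,ν), V(x+e_ν,μ), V(∂p)) = Haar³ ⊗ law(V(∂p))` — so the joint law of a plaquette's four variables is `Haar³ ⊗ κ_p` in the coordinates (tree, holonomy),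
`κ_p` the law of the holonomy: the only shape a plaquette polymer can carry is a function of its holonomy. [cite: Balaban1987RG1, (2.1) p.265; Balaban1985Averaging, (9) p.19 (bookkeeping — NOT in print)] -/
theorem map_plaquetteTree_prod_plaqHol (h : j + 1 < P.m + P.K) (p : Plaq P (j + 1)) (ν : Measure (GaugeField P (j + 1) G)) (hfin : IsFiniteMeasure ν)
    (hν : ∀ v : GaugeTransf P (j + 1) G, ν.map (GaugeField.gaugeAct v) = ν) :
    ν.map (fun V : GaugeField P (j + 1) G =>
        ((fun m : Fin 3 => V ((![⟨p.src, p.μ⟩, ⟨p.src.shift p.μ, p.ν⟩, ⟨p.src.shift p.ν, p.μ⟩] : Fin 3 → PBond P (j + 1)) m)), GaugeField.plaqHol V p)) =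
      (Measure.pi fun _ : Fin 3 => (HaarData.haar : Measure G)).prod (ν.map fun V => GaugeField.plaqHol V p) := by
  classical
  have hev : ∀ c : PBond P (j + 1), Measurable fun V : GaugeField P (j + 1) G => V c := fun c => measurable_pi_apply c
  have hholm : Measurable fun V : GaugeField P (j + 1) G => GaugeField.plaqHol V p := by
    unfold GaugeField.plaqHol
    exact (((hev _).mul (hev _)).mul (hev _).inv).mul (hev _).inv
  refine map_evalFamily_prod_eq_of_gaugeInvariant _ (![false, false, true]) (plaquetteTree_leafOrder h p) ν hfin hν _ hholm fun m g V =>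
    plaqHol_gaugeAct_of_apply_src p _ ?_ V
  -- the base point `x` is none of the private endpoints
  have h1 : p.src ≠ p.src.shift p.μ := src_ne_tgt (⟨p.src, p.μ⟩ : PBond P (j + 1))
  have h2 : p.src ≠ (p.src.shift p.μ).shift p.ν := fun e => shift_shift_ne_self h p.src p.μ p.ν e.symm
  have h3 : p.src ≠ p.src.shift p.ν := src_ne_tgt (⟨p.src, p.ν⟩ : PBond P (j + 1))
  fin_cases m
  · exact if_neg h1
  · exact if_neg h2
  · exact if_neg h3

end Plaquette

end Summit.QuantumFields.YangMills.BalabanUVNodes.N08HaarCompatibilityForestsSpectator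

end
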